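import Summits.CriticalPhenomena.PercolationContinuityZ3.Theorems.PercNearOneGluingNoHeavyLowerTailEventGluingSharp
import Summits.CriticalPhenomena.PercolationContinuityZ3.Theorems.PercNearOneGluingNoHeavyLowerTailKNConj4AllWeights
import HarnessLib

/-!
# perc-kn LINE SKELETON (statement of record) — Kozma–Nitzan's other conjectures: the residual after the Phase-0 inventory

Cell perc-kn (req609-KN), lead `perc-kn-lead` g0.  Crux workfile `Cruxes/<4575>/Lines/kn_genmin.lean` for `stmt-CriticalPhenomena-4575`.

PHASE-0 INVENTORY (lead, 2026-09-03): Kozma–Nitzan Conj. 1 printed form (`kozmaNitzan2024_conjecture1_holds`), (GEN) for monotone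
`F ≥ 0` (`EventGluingSharp.gen_holds`), the pre-FKG inequality at every minimiser for every monotone `F` at ALL weights
(`Q7Psi.kn_conj4_designated`), Question 7 (`Q7Psi.kn_question7`), Conj. 2 (`PreFKGSurplus.kn_conj2`, `Q7Psi.kn_conj2_designated`),
Conj. 4 printed `∃`-form at ALL weights (`PreFKGSurplus.kn_conj4`), AND QUESTION 5 (finite minimax / Farkas:
`UniversalGluing.universal_upset_coefficients`, `UniversalGluing.universal_coefficients`, `UniversalGluing.kn_question5`) are ALREADY
sorry-free kernel theorems imported by `Summits.CriticalPhenomena.Status.Root` (standard axioms).  The brief's files F3–F9 are therefore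
NOT re-proved.  What remains (this skeleton, one theorem per prover file):

* F1  `EventGluingSharp.genMin_holds` — (GENmin) for every monotone `F` (the hypothesis `0 ≤ F` of `gen_holds` dropped):
      `μ(o ↔ A)·min_a m_a ≤ Σ_a μ(P^o_a)·m_a ≤ E[F(C_o); o ↔ A]` (rank form, `r` injective on `A` and `m`-compatible).
* F2  `kn_conjecture1_monotone` — Kozma–Nitzan's Conjecture 1 for monotone cluster functionals, rank-free, all weights:
      `μ(o ↔ A)·min_{a∈A} E F(C_a) ≤ E[F(C_o); o ↔ A]`; plus the printed Conjecture 1 re-derived from it (consistency `example`).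
* F10 `PreFKGSurplus.kn_conj4_min` — Conj. 4 in the printed `min` shape at all weights:
      `min_{a∈A} E[F(C_a); o ↔ A] ≤ E[F(C_o); o ↔ A]`.

Target modules (namespace `Summit.CriticalPhenomena.PercolationContinuityZ3.Theorems`):
F1 → `Theorems/PercNearOneGluingNoHeavyLowerTailKNGenMin.lean`, F2 → `Theorems/PercNearOneGluingNoHeavyLowerTailKNConjecture1Monotone.lean`,
F10 → `Theorems/PercNearOneGluingNoHeavyLowerTailKNConjecture4Min.lean`.
[cite: KozmaNitzan2024, Conj. 1 (p. 3), Conj. 4 (p. 32), Question 5 (p. 32–33)]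
-/

noncomputable section

namespace Summit.CriticalPhenomena.PercolationContinuityZ3.Theorems

open MeasureTheory Set
open Literature.Probability.LatticeModels (prodBernoulli)
open Literature.Probability.Percolation
open scoped Classical

namespace EventGluingSharp

/-- **F1 — (GENmin) for every monotone cluster functional, on every finite weighted graph (weights in `[0,1]`).**  For `F` monotone on
vertex sets (no sign hypothesis), a nonempty relay set `A`, an observer `o` and a rank `r` injective on `A` and compatible with
`a ↦ m_a := E F(C_a)`:  `μ(o ↔ A)·min_{a∈A} m_a ≤ Σ_{a∈A} μ({o ↔ a} ∩ ⋂_{a'∈A, r a' < r a} {o ↮ a'})·m_a ≤ ∫_{o ↔ A} F(C_o) dμ`.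
(`gen_holds` applied to `F − F(∅) ≥ 0`; the first-in-rank patterns partition `{o ↔ A}`, `AGloc.sum_measureReal_firstRank`.)
[cite: KozmaNitzan2024, Conj. 1 (p. 3), Conj. 4 (p. 32)] -/
theorem genMin_holds (n : ℕ) (w : Sym2 (Fin n) → unitInterval) (A : Finset (Fin n)) (hA : A.Nonempty) (o : Fin n)
    (F : Set (Fin n) → ℝ) (r : Fin n → ℕ) (hF : ∀ S S' : Set (Fin n), S ⊆ S' → F S ≤ F S') (hr : Set.InjOn r ↑A)
    (hcompat : ∀ a ∈ A, ∀ a' ∈ A, r a < r a' →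
      ∫ ω, F (openCluster ω a) ∂(prodBernoulli w) ≤ ∫ ω, F (openCluster ω a') ∂(prodBernoulli w)) :
    (prodBernoulli w).real (⋃ a ∈ A, openConn o a) * A.inf' hA (fun a => ∫ ω, F (openCluster ω a) ∂(prodBernoulli w)) ≤
        ∑ a ∈ A, (prodBernoulli w).real
            (openConn o a ∩ ⋂ a' ∈ A.filter (fun a' => r a' < r a), (openConn o a')ᶜ : Set (BondConfig (Fin n))) *
          ∫ ω, F (openCluster ω a) ∂(prodBernoulli w) ∧
      ∑ a ∈ A, (prodBernoulli w).real
            (openConn o a ∩ ⋂ a' ∈ A.filter (fun a' => r a' < r a), (openConn o a')ᶜ : Set (BondConfig (Fin n))) *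
          ∫ ω, F (openCluster ω a) ∂(prodBernoulli w) ≤
        ∫ ω in (⋃ a ∈ A, openConn o a), F (openCluster ω o) ∂(prodBernoulli w) := by
  set μ := prodBernoulli w with hμ
  set W : Set (BondConfig (Fin n)) := ⋃ a ∈ A, openConn o a with hW
  set m : Fin n → ℝ := fun a => ∫ ω, F (openCluster ω a) ∂μ with hm
  have hsum := AGloc.sum_measureReal_firstRank w A r o hr
  rw [← hμ] at hsum
  refine ⟨?_, ?_⟩
  · -- `μ(W)·min m = Σ_a μ(P_a)·min m ≤ Σ_a μ(P_a)·m_a`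
    rw [← hsum, Finset.sum_mul]
    exact Finset.sum_le_sum fun a ha => mul_le_mul_of_nonneg_left (Finset.inf'_le _ ha) measureReal_nonneg
  · -- shift: `G := F − F ∅ ≥ 0` is monotone with the same compatible rank
    set G : Set (Fin n) → ℝ := fun S => F S - F ∅ with hG
    have hGmono : ∀ S S' : Set (Fin n), S ⊆ S' → G S ≤ G S' := fun S S' h => sub_le_sub_right (hF S S' h) _
    have hG0 : ∀ S, 0 ≤ G S := fun S => sub_nonneg.2 (hF ∅ S (empty_subset S))
    have hintG : ∀ x : Fin n, ∫ ω, G (openCluster ω x) ∂μ = m x - F ∅ := by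
      intro x
      simp only [hG]
      rw [integral_sub Integrable.of_finite Integrable.of_finite, integral_const, smul_eq_mul, probReal_univ, one_mul]
    have hcompatG : ∀ a ∈ A, ∀ a' ∈ A, r a < r a' →
        ∫ ω, G (openCluster ω a) ∂μ ≤ ∫ ω, G (openCluster ω a') ∂μ := by
      intro a ha a' ha' hlt
      rw [hintG a, hintG a']
      exact sub_le_sub_right (hcompat a ha a' ha' hlt) _
    have key := gen_holds n w A o G r hGmono hG0 hr hcompatG
    rw [← hμ] at key
    simp only [hintG] at key
    have hsetG : ∫ ω in W, G (openCluster ω o) ∂μ = ∫ ω in W, F (openCluster ω o) ∂μ - F ∅ * μ.real W := by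
      simp only [hG]
      rw [integral_sub Integrable.of_finite Integrable.of_finite, setIntegral_const, smul_eq_mul, mul_comm]
    rw [hsetG] at key
    have hsplit : ∑ a ∈ A, μ.real (openConn o a ∩ ⋂ a' ∈ A.filter (fun a' => r a' < r a), (openConn o a')ᶜ :
          Set (BondConfig (Fin n))) * (m a - F ∅) =
        ∑ a ∈ A, μ.real (openConn o a ∩ ⋂ a' ∈ A.filter (fun a' => r a' < r a), (openConn o a')ᶜ :
          Set (BondConfig (Fin n))) * m a - F ∅ * μ.real W := by
      rw [← hsum, Finset.mul_sum, ← Finset.sum_sub_distrib]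
      exact Finset.sum_congr rfl fun a _ => by ring
    rw [hsplit] at key
    linarith

end EventGluingSharp

/-- **F2 — Kozma–Nitzan's Conjecture 1 for monotone cluster functionals, rank-free, on every finite weighted graph (weights in `[0,1]`).**
For `F` monotone on vertex sets, `A ≠ ∅` and any `o`:  `μ(o ↔ A)·min_{a∈A} E F(C_a) ≤ ∫_{o ↔ A} F(C_o) dμ`.
(`EventGluingSharp.genMin_holds` with an `E F(C_·)`-compatible injective rank, `AGloc.exists_rank_compat`.)  The printed Conjecture 1
(`F = 1{b ∈ ·}`) is re-derived below. [cite: KozmaNitzan2024, Conj. 1 (p. 3), §5.1 monotone cluster properties (p. 31–32)] -/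
theorem kn_conjecture1_monotone (n : ℕ) (w : Sym2 (Fin n) → unitInterval) (A : Finset (Fin n)) (hA : A.Nonempty) (o : Fin n)
    (F : Set (Fin n) → ℝ) (hF : ∀ S S' : Set (Fin n), S ⊆ S' → F S ≤ F S') :
    (prodBernoulli w).real (⋃ a ∈ A, openConn o a) * A.inf' hA (fun a => ∫ ω, F (openCluster ω a) ∂(prodBernoulli w)) ≤
      ∫ ω in (⋃ a ∈ A, openConn o a), F (openCluster ω o) ∂(prodBernoulli w) := by
  obtain ⟨r, hr, hrc⟩ := AGloc.exists_rank_compat A (fun a => ∫ ω, F (openCluster ω a) ∂(prodBernoulli w))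
  have h := EventGluingSharp.genMin_holds n w A hA o F r hF hr hrc
  exact h.1.trans h.2

/-- Consistency / non-vacuity check: the registered printed Conjecture 1 follows from `kn_conjecture1_monotone` at `F = 1{b ∈ ·}`. -/
example : Literature.StrongHypotheses.CriticalPhenomena.KozmaNitzan2024_conjecture1 := by
  intro n w A o b t ht
  set μ := prodBernoulli w with hμ
  have hmeas : ∀ S : Set (BondConfig (Fin n)), MeasurableSet S := fun S => (Set.toFinite S).measurableSet
  rcases A.eq_empty_or_nonempty with hA | hA
  · rw [hA]
    simp [measureReal_nonneg]
  set F : Set (Fin n) → ℝ := fun M => if b ∈ M then 1 else 0 with hFdef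
  have hFmono : ∀ S T : Set (Fin n), S ⊆ T → F S ≤ F T := by
    intro S T hST
    simp only [hFdef]
    by_cases hS : b ∈ S
    · rw [if_pos hS, if_pos (hST hS)]
    · rw [if_neg hS]
      split_ifs <;> norm_num
  have hFind : ∀ x : Fin n, (fun ω : BondConfig (Fin n) => F (openCluster ω x)) =
      (openConn x b : Set (BondConfig (Fin n))).indicator 1 := by
    intro x
    funext ω
    simp only [hFdef]
    by_cases hω : ω ∈ (openConn x b : Set (BondConfig (Fin n)))
    · rw [Set.indicator_of_mem hω, Pi.one_apply, if_pos (show b ∈ openCluster ω x from hω)]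
    · rw [Set.indicator_of_notMem hω, if_neg (show b ∉ openCluster ω x from hω)]
  have hint : ∀ x : Fin n, ∫ ω, F (openCluster ω x) ∂μ = μ.real (openConn x b) := by
    intro x
    rw [hFind x, integral_indicator_one (hmeas _)]
  have hsetint : ∫ ω in (⋃ a ∈ A, openConn o a), F (openCluster ω o) ∂μ =
      μ.real ((⋃ a ∈ A, openConn o a) ∩ openConn o b : Set (BondConfig (Fin n))) := by
    rw [hFind o, ← integral_indicator (hmeas _), Set.indicator_indicator,
      integral_indicator_one ((hmeas _).inter (hmeas _))]
  have key := kn_conjecture1_monotone n w A hA o F hFmono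
  rw [← hμ] at key
  simp only [hint] at key
  rw [hsetint] at key
  have ht' : t ≤ A.inf' hA (fun a => μ.real (openConn a b)) := by
    rw [Finset.le_inf'_iff]
    exact ht
  calc μ.real (⋃ a ∈ A, openConn o a) * t
      ≤ μ.real (⋃ a ∈ A, openConn o a) * A.inf' hA (fun a => μ.real (openConn a b)) :=
        mul_le_mul_of_nonneg_left ht' measureReal_nonneg
    _ ≤ μ.real ((⋃ a ∈ A, openConn o a) ∩ openConn o b : Set (BondConfig (Fin n))) := key
    _ ≤ μ.real (openConn o b) := measureReal_mono Set.inter_subset_right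

namespace PreFKGSurplus

/-- **F10 — Kozma–Nitzan's Conjecture 4 in the printed `min` shape, every weight vector in `[0,1]^E`**: for `F` monotone on vertex sets,
`A ≠ ∅` and any `o`, `min_{a∈A} E[F(C_a); o ↔ A] ≤ E[F(C_o); o ↔ A]`.  (`PreFKGSurplus.kn_conj4`.) [cite: KozmaNitzan2024, Conj. 4 (p. 32)] -/
theorem kn_conj4_min {n : ℕ} (w : Sym2 (Fin n) → unitInterval) (A : Finset (Fin n)) (hA : A.Nonempty) (o : Fin n)
    (F : Set (Fin n) → ℝ) (hF : ∀ S T : Set (Fin n), S ⊆ T → F S ≤ F T) :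
    A.inf' hA (fun a => ∫ ω in ⋃ a' ∈ A, openConn o a', F (openCluster ω a) ∂(prodBernoulli w)) ≤
      ∫ ω in ⋃ a' ∈ A, openConn o a', F (openCluster ω o) ∂(prodBernoulli w) := by
  obtain ⟨a, ha, h⟩ := kn_conj4 w A o F hF hA
  exact (Finset.inf'_le _ ha).trans h

end PreFKGSurplus

end Summit.CriticalPhenomena.PercolationContinuityZ3.Theorems

end
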